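import Literature.Computability.QuantumComplexity.PromiseClassesRel
import Literature.Computability.QuantumComplexity.RazTalPrefixedMachine
import Literature.Barriers.QuantumAdvantage.FortnowRogersBrainWorld
import Literature.Barriers.QuantumAdvantage.Relativization
import Literature.Computability.QuantumComplexity.OracleSeparationsProofs
import Literature.Computability.QuantumComplexity.OracleSeparationBQPBPP
import Literature.Computability.QuantumComplexity.OracleCircuitLocality
import HarnessLib

/-!
# Barrier catalogue `QuantumAdvantage`: the promise lift `BQP ⊆ BPP ⟹ PromiseBQP ⊆ PromiseBPP'` does not relativize

D-0021 barrier entry for the summit `QuantumAdvantage` (`∃ L, L ∈ BQP ∧ L ∉ BPP`), aimed at the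
shared route item **`PlLift : BQP ⊆ BPP → PromiseBQP ⊆ PromiseBPP'`** (stmt-QuantumAdvantage-0250;
routes `PromiseLift`, `CubicForrelation`, `CodeCarries`, `RandomOracleGauge`, `ExponentLadder`,
`SpikesNeedAddresses`, `WhiteBoxWalk`), the quantum analogue of Goldreich's open problem "does
`BPP = P` for decision problems imply `prBPP = prP`?" (Goldreich 2011, §6) and of Aaronson–Arkhipov's
distinction between the hypotheses "`P = BQP`" and "`PromiseP = PromiseBQP`" (Theory of Computing
9 (2013), §10, open problems (9)–(10): the Fortnow–Rogers world with `P = BQP` is "not even known"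
to extend to `PromiseP = PromiseBQP`).

**The result proved here (new).** There is an oracle language `A` with

  `BQP^A ⊆ BPP^A`  (indeed `BQP^A ⊆ AWPP^A = P^A`)  and  `PromiseBQP^A ⊄ PromiseBPP'^A`

(`PromiseLiftRelativization.holds`; classes `BQPRel`, `BPPRel`, and the relativized textbook promise
classes `PromiseBQPRel`, `PromiseBPP'Rel` of `PromiseClassesRel.lean`). Hence the promise lift has NO
RELATIVIZING PROOF (`not_relativizes_promiseLift`), and neither has the promise collapse
`PromiseBQP ⊆ PromiseBPP'` (`not_relativizes_promiseCollapse`) nor the separability hypothesis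
"`PromiseBQP ⊆ promiseLift BQP`" through which route `PromiseLift` attacks the lift
(`not_PromiseBQPRel_subset_promiseLift`); the CONVERSE lift `PromiseBQP ⊆ PromiseBPP' ⟹ BQP ⊆ BPP`
does relativize (`relativizes_promiseLift_converse`). The same world has `P^A = BQP^A` and `PH^A`
infinite (`exists_oracle_P_eq_BQP_infinitePH_promiseBQP_not_subset`): the row "`PromiseP =
PromiseBQP` ⟹ `PH` collapses (relativizing)?" of Aaronson–Arkhipov's table (§10 (10), p. 236: "it is
not even known how to extend the Fortnow–Rogers construction to get an oracle `A` relative to which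
`PromiseP = PromiseBQP` but `PH` is infinite") is decided NEGATIVELY for the Fortnow–Rogers-type
world itself: there `PromiseP ≠ PromiseBQP` although `P = BQP`.

**The oracle.** `A = K ⊕ G`, where `K` is the brain oracle of the tree's discharge of
Fortnow–Rogers' Cor. 3.7 (`Cor37Brain.oracleK`, `FortnowRogersBrainWorld.lean`: Fortnow–Rogers 1999,
Cor. 3.7 "there exists a relativized world where `P = BQP` and the polynomial-time hierarchy is
infinite", via Fenner–Fortnow–Kurtz–Li's generic collapse `P^{B ⊕ G} = AWPP^{B ⊕ G}`, Thm. 6.18 (2),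
and the relativized `BQP ⊆ AWPP`, Thm. 3.1) and `G` is Cohen generic for the union of the (countable)
FFKL collapse family of `K` and of countably many FAILURE REQUIREMENTS, one per description
`(M, q, p)` of a `BPP^A` promise machine:

* collapse: `BQP^{K ⊕ G} ⊆ AWPP^{K ⊕ G} = P^{K ⊕ G} ⊆ BPP^{K ⊕ G}` (tree theorems
  `BQPRel_subset_AWPPRel_holds`, `FFKL.PRel_eq_AWPPRel_of_isGeneric_of_stdAlg Cor37Brain.stdAlg_oracleK`,
  `PRel_subset_BPPRel_holds`);
* separation: the promise problem `Q = ({x : acc ≥ 2/3}, {x : acc ≤ 1/3})` of the prefixed Raz–Tal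
  machine (`razTalPrefixed_bqpMachine`, `RazTalPrefixedMachine.lean`: Raz–Tal's amplified Forrelation
  test `Q₁` reading the level-`n` window at the addresses `1 · rtAddr n i k`, i.e. the window of `G`)
  is in `PromiseBQP^{K ⊕ G}` by definition, and lies outside `PromiseBPP'^{K ⊕ G}` because every
  requirement is met: for each `(M, q, p)` some level `n` has `Q₁` on one side of the promise while
  the acceptance probability of `(M, q, p)` at `1ⁿ` is not (`PromiseLiftFailsAt`). The requirements
  are DENSE (`exists_forces_promiseLiftFailsAt`): Raz–Tal's stage lemma against `BPP` descriptions
  (tree theorem `exists_defeating_window_bpp`: Raz–Tal 2022, App. A with Claims 8.1–8.2, run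
  against bounded-error probabilistic machines as in Bernstein–Vazirani 1997, Cor. 8.14) is applied
  to the machine `withLocalRule M (joinRule K q)` with the BASE OF THE JOIN INTERNALIZED (a replay
  construction answering the `0·`-queries by `K` itself, `baseLang_withLocalRule_joinRule`) and an
  arbitrary background extending the given finite condition; the defeating window is patched into
  level `n` and everything up to the reach of the description is frozen into a finite Cohen
  condition. (For a GENERIC `G` most levels are garbage, so the LANGUAGE `{1ⁿ : acc ≥ 2/3}` of the
  machine is not in `BQP^{K ⊕ G}` — this is why the language separation dies in the world where
  `P = BQP` while the promise separation survives.)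

## Contents

* `LocalRule`, `withLocalRule` and the run lemma `run_withLocalRule` (oracle algorithms with some
  queries answered locally: replay construction, Ladner–Lynch–Selman 1975, §2); `joinRule`,
  `sim_joinRule`, `baseLang_withLocalRule_joinRule` (bookkeeping reused from the tree:
  `boolIndicator_eq_of_iff`, `BGS.extendedBy_setOf_val_eq_true`, `BGS.exists_length_le_of_mem_dom`,
  `shortStrings`);
* `PromiseLiftFailsAt` (the failure predicate), `exists_forces_promiseLiftFailsAt` (density);
* `machinePromise` (the promise problem of a family; `machinePromise_mem_PromiseBQPRel`),
  `exists_generic_world_of_collapse` (any base with a generic `P = AWPP` collapse),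
  `exists_generic_world` (the brain world `K ⊕ G`: `P = AWPP`, `PH` infinite, promise separation;
  unconditional), `exists_generic_world_of_thm618` (the printed world `H ⊕ G`, `H`
  `PSPACE`-complete, conditional on the named fact `fennerFortnowKurtzLi2003_thm618_awpp`),
  `exists_generic_promiseLift_fails`, `exists_oracle_P_eq_BQP_infinitePH_promiseBQP_not_subset`;
* the barrier fact `PromiseLiftRelativization` with `PromiseLiftRelativization.holds`, and the
  no-go theorems `not_relativizes_promiseLift`, `not_relativizes_promiseCollapse`,
  `relativizes_promiseLift_converse`, `promiseLift_BPPRel_subset_PromiseBPP'Rel`,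
  `not_PromiseBQPRel_subset_promiseLift`, and the anchor `promiseLift_shape_empty_iff` (at the
  empty oracle the family is literally `BQP ⊆ BPP → PromiseBQP ⊆ PromiseBPP'`).

## References (Aaronson–Arkhipov p. 236 read with `lit read doi:10.4086/toc.2013.v009a004`; the other locators as page-checked in the sibling files `FortnowRogersOracle.lean`, `FortnowRogersBrainWorld.lean`, `OracleSeparationBQPPH.lean`, `Relativization.lean`)

* L. Fortnow, J. Rogers, *Complexity limitations on quantum computation*, JCSS 59 (1999)
  (arXiv:cs/9811023), Thm. 3.1, Thm. 3.6, Cor. 3.7 and the proof of Thm. 4.2 (the join `H ⊕ G`)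
  [FortnowRogers1999JCSS].
* S. Fenner, L. Fortnow, S. Kurtz, L. Li, *An oracle builder's toolkit*, Inform. and Comput. 182
  (2003), Thm. 6.18 (2), Lemma 3.12 [FennerFortnowKurtzLi2003IC].
* R. Raz, A. Tal, *Oracle separation of BQP and PH*, J. ACM 69 (2022), App. A, Claims 8.1–8.2,
  Cor. 1.5 [RazTalJACM2022].
* E. Bernstein, U. Vazirani, *Quantum complexity theory*, SIAM J. Comput. 26 (1997), §8.4,
  Cor. 8.14 [BernsteinVazirani1997].
* S. Aaronson, A. Arkhipov, *The computational complexity of linear optics*, Theory of Computing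
  9 (2013), §10, open problems (9)–(10) [AaronsonArkhipov2013].
* O. Goldreich, *In a world of P = BPP*, LNCS 6650 (2011), §6 [Goldreich2011]; *On promise
  problems: a survey*, LNCS 3895 (2006), Def. 1.2, §1.2 [Goldreich2006].
* R. E. Ladner, N. A. Lynch, A. L. Selman, *A comparison of polynomial time reducibilities*,
  Theoret. Comput. Sci. 1 (1975), §2 [LadnerLynchSelman1975].
* S. Arora, B. Barak, *Computational Complexity: A Modern Approach*, CUP 2009, §3.4, Thm. 3.7
  [AroraBarakCC2009].
-/

noncomputable section

namespace Literature.Barriers.QuantumAdvantage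

open _root_.Computability Literature.Computability.Complexity Literature.Computability.Complexity.Classes
  Literature.Computability.Cryptography Literature.Computability.QuantumComplexity PneNP

/-! ### Oracle algorithms with some queries answered locally (replay construction) -/

section WithLocal

variable {β : Type}

/-- A **local-answer rule** for an oracle algorithm: on input `x`, the query `s` is either answered
locally (`loc x s = some a`) or forwarded to the outer oracle as `fwd x s`; `fuel x` bounds the
number of simulated rounds. [folklore] -/
structure LocalRule where
  /-- local answers -/
  loc : List Bool → List Bool → Option (List Bool)
  /-- translation of forwarded queries -/
  fwd : List Bool → List Bool → List Bool
  /-- round budget of the simulated machine -/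
  fuel : List Bool → ℕ

/-- The oracle seen by the simulated machine: local answers, else the outer oracle on the forwarded
query. [folklore] -/
def LocalRule.sim (ρ : LocalRule) (O' : Oracle) (x : List Bool) : Oracle :=
  fun s => match ρ.loc x s with
    | some a => a
    | none => O' (ρ.fwd x s)

/-- Replay of `M` on `x` from the transcript `acc`, consuming the outer answers `outer` at forwarded
queries: returns the next forwarded query, or `M`'s output, or the dummy query `[]` when the fuel
is exhausted ("answer each query of the first procedure by running the second", replayed from the
answers received so far). [cite: LadnerLynchSelman1975, §2] -/
def localReplay (ρ : LocalRule) (M : OracleAlg β) (x : List Bool) :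
    ℕ → List (List Bool) → List (List Bool) → List Bool ⊕ β
  | 0, _, _ => Sum.inl []
  | f + 1, acc, outer =>
    match M.step x acc with
    | Sum.inr b => Sum.inr b
    | Sum.inl s =>
      match ρ.loc x s with
      | some a => localReplay ρ M x f (acc ++ [a]) outer
      | none =>
        match outer with
        | [] => Sum.inl (ρ.fwd x s)
        | o :: outer' => localReplay ρ M x f (acc ++ [o]) outer'

/-- **`M` with the local rule `ρ`**: the oracle algorithm whose queries are the forwarded queries
of `M`, the other queries of `M` being answered by `ρ`. [cite: LadnerLynchSelman1975, §2] -/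
def withLocalRule (M : OracleAlg β) (ρ : LocalRule) : OracleAlg β where
  step x outer := localReplay ρ M x (ρ.fuel x) [] outer

variable (ρ : LocalRule) (M : OracleAlg β) (O' : Oracle) (x : List Bool)

/-- The forwarded queries (already translated) along the run of `M` against `ρ.sim O' x`. [folklore] -/
def localFwQry : ℕ → List (List Bool) → List (List Bool)
  | 0, _ => []
  | f + 1, acc =>
    match M.step x acc with
    | Sum.inr _ => []
    | Sum.inl s =>
      match ρ.loc x s with
      | some a => localFwQry f (acc ++ [a])
      | none => ρ.fwd x s :: localFwQry f (acc ++ [O' (ρ.fwd x s)])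

/-- Packaging of a run result as a replay result. [folklore] -/
def localRes : Option β → List Bool ⊕ β
  | some b => Sum.inr b
  | none => Sum.inl []

variable {ρ M O' x}

/-- **Full replay**: fed with (at least) all the outer answers of the run, the replay returns the
result of the run of `M` against the simulated oracle (or the dummy query if `M` does not halt).
[cite: LadnerLynchSelman1975, §2] -/
theorem localReplay_full : ∀ (f : ℕ) (acc extra : List (List Bool)),
    localReplay ρ M x f acc ((localFwQry ρ M O' x f acc).map O' ++ extra) =
      localRes (M.runAux (ρ.sim O' x) x f acc)
  | 0, _, _ => rfl
  | f + 1, acc, extra => by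
    rw [OracleAlg.runAux_succ]
    simp only [localReplay, localFwQry]
    cases hs : M.step x acc with
    | inr b => rfl
    | inl s =>
      simp only
      cases hl : ρ.loc x s with
      | some a =>
        simp only
        have hsim : ρ.sim O' x s = a := by simp [LocalRule.sim, hl]
        rw [localReplay_full f (acc ++ [a]) extra, hsim]
      | none =>
        simp only [List.map_cons, List.cons_append]
        have hsim : ρ.sim O' x s = O' (ρ.fwd x s) := by simp [LocalRule.sim, hl]
        rw [localReplay_full f _ extra, hsim]

/-- **Partial replay**: fed with a proper prefix of the outer answers, the replay asks the next
forwarded query. [cite: LadnerLynchSelman1975, §2] -/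
theorem localReplay_prefix : ∀ (f : ℕ) (acc : List (List Bool)) (i : ℕ) (q : List Bool),
    (localFwQry ρ M O' x f acc)[i]? = some q →
      localReplay ρ M x f acc (((localFwQry ρ M O' x f acc).map O').take i) = Sum.inl q
  | 0, _, i, q, h => by simp [localFwQry] at h
  | f + 1, acc, i, q, h => by
    cases hs : M.step x acc with
    | inr b => simp [localFwQry, hs] at h
    | inl s =>
      cases hl : ρ.loc x s with
      | some a =>
        have h' : (localFwQry ρ M O' x f (acc ++ [a]))[i]? = some q := by simpa [localFwQry, hs, hl] using h
        have e1 : localFwQry ρ M O' x (f + 1) acc = localFwQry ρ M O' x f (acc ++ [a]) := by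
          simp [localFwQry, hs, hl]
        have e2 : ∀ outer, localReplay ρ M x (f + 1) acc outer = localReplay ρ M x f (acc ++ [a]) outer :=
          fun outer => by simp [localReplay, hs, hl]
        rw [e1, e2]
        exact localReplay_prefix f _ i q h'
      | none =>
        have e1 : localFwQry ρ M O' x (f + 1) acc =
            ρ.fwd x s :: localFwQry ρ M O' x f (acc ++ [O' (ρ.fwd x s)]) := by
          simp [localFwQry, hs, hl]
        rw [e1] at h ⊢
        cases i with
        | zero =>
          simp only [List.getElem?_cons_zero, Option.some.injEq] at h
          subst h
          simp [localReplay, hs, hl]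
        | succ i =>
          simp only [List.getElem?_cons_succ] at h
          simp only [List.map_cons, List.take_succ_cons]
          have e2 : ∀ outer, localReplay ρ M x (f + 1) acc (O' (ρ.fwd x s) :: outer) =
              localReplay ρ M x f (acc ++ [O' (ρ.fwd x s)]) outer := fun outer => by
            simp [localReplay, hs, hl]
          rw [e2]
          exact localReplay_prefix f _ i q h

/-- In a halting run the forwarded queries are fewer than the fuel. [folklore] -/
theorem length_localFwQry_lt : ∀ (f : ℕ) (acc : List (List Bool)) (b : β),
    M.runAux (ρ.sim O' x) x f acc = some b → (localFwQry ρ M O' x f acc).length < f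
  | 0, _, _, h => by simp at h
  | f + 1, acc, b, h => by
    rw [OracleAlg.runAux_succ] at h
    simp only [localFwQry]
    cases hs : M.step x acc with
    | inr b' => simp
    | inl s =>
      simp only [hs] at h
      simp only
      cases hl : ρ.loc x s with
      | some a =>
        simp only
        have hsim : ρ.sim O' x s = a := by simp [LocalRule.sim, hl]
        rw [hsim] at h
        exact Nat.lt_succ_of_lt (length_localFwQry_lt f _ b h)
      | none =>
        simp only [List.length_cons]
        have hsim : ρ.sim O' x s = O' (ρ.fwd x s) := by simp [LocalRule.sim, hl]
        rw [hsim] at h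
        exact Nat.succ_lt_succ (length_localFwQry_lt f _ b h)

/-- If `M` does not halt, `withLocalRule` keeps asking (dummy) queries. [folklore] -/
theorem withLocalRule_runAux_none (h : M.runAux (ρ.sim O' x) x (ρ.fuel x) [] = none) :
    ∀ (k : ℕ) (junk : List (List Bool)),
      (withLocalRule M ρ).runAux O' x k ((localFwQry ρ M O' x (ρ.fuel x) []).map O' ++ junk) = none
  | 0, _ => rfl
  | k + 1, junk => by
    rw [OracleAlg.runAux_succ]
    have hstep : (withLocalRule M ρ).step x ((localFwQry ρ M O' x (ρ.fuel x) []).map O' ++ junk) = Sum.inl [] := by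
      show localReplay ρ M x (ρ.fuel x) [] _ = _
      rw [localReplay_full, h]; rfl
    rw [hstep]
    simp only
    rw [List.append_assoc]
    exact withLocalRule_runAux_none h k (junk ++ [O' []])

/-- The run of `withLocalRule` from a prefix of the outer answers. [folklore] -/
theorem withLocalRule_runAux_take (k i : ℕ) (hi : i ≤ (localFwQry ρ M O' x (ρ.fuel x) []).length) :
    (withLocalRule M ρ).runAux O' x k (((localFwQry ρ M O' x (ρ.fuel x) []).map O').take i) =
      if (localFwQry ρ M O' x (ρ.fuel x) []).length - i + 1 ≤ k then M.runAux (ρ.sim O' x) x (ρ.fuel x) []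
      else none := by
  induction k generalizing i with
  | zero => simp
  | succ k ih =>
    set Q := localFwQry ρ M O' x (ρ.fuel x) [] with hQ
    rw [OracleAlg.runAux_succ]
    rcases lt_or_eq_of_le hi with hlt | rfl
    · have hget : Q[i]? = some Q[i] := List.getElem?_eq_getElem hlt
      have hstep : (withLocalRule M ρ).step x ((Q.map O').take i) = Sum.inl Q[i] := by
        show localReplay ρ M x (ρ.fuel x) [] _ = _
        exact localReplay_prefix (ρ.fuel x) [] i Q[i] hget
      rw [hstep]
      simp only
      have htake : (Q.map O').take i ++ [O' Q[i]] = (Q.map O').take (i + 1) := by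
        rw [List.take_add_one, List.getElem?_map, hget]; simp
      rw [htake, ih (i + 1) hlt]
      by_cases hc : Q.length - i + 1 ≤ k + 1
      · rw [if_pos hc, if_pos (by omega)]
      · rw [if_neg hc, if_neg (by omega)]
    · have htake : (Q.map O').take Q.length = Q.map O' := by simp
      rw [htake]
      have hstep : (withLocalRule M ρ).step x (Q.map O') = localRes (M.runAux (ρ.sim O' x) x (ρ.fuel x) []) := by
        show localReplay ρ M x (ρ.fuel x) [] _ = _
        simpa using localReplay_full (ρ := ρ) (M := M) (O' := O') (x := x) (ρ.fuel x) [] []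
      rw [hstep]
      cases hrun : M.runAux (ρ.sim O' x) x (ρ.fuel x) [] with
      | some b => simp [localRes]
      | none =>
        simp only [localRes]
        rw [withLocalRule_runAux_none hrun k [O' []]]
        simp

/-- **Run lemma**: with at least `fuel x` rounds, `M` with the local rule `ρ` against `O'` returns
what `M` returns against the simulated oracle within `fuel x` rounds. [cite: LadnerLynchSelman1975, §2] -/
theorem run_withLocalRule {k : ℕ} (hk : ρ.fuel x ≤ k) :
    (withLocalRule M ρ).run O' k x = M.run (ρ.sim O' x) (ρ.fuel x) x := by
  have h := withLocalRule_runAux_take (ρ := ρ) (M := M) (O' := O') (x := x) k 0 (Nat.zero_le _)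
  rw [List.take_zero] at h
  change (withLocalRule M ρ).runAux O' x k [] = M.runAux (ρ.sim O' x) x (ρ.fuel x) []
  rw [h]
  cases hrun : M.runAux (ρ.sim O' x) x (ρ.fuel x) [] with
  | none => simp
  | some b =>
    have := length_localFwQry_lt (ρ := ρ) (M := M) (O' := O') (x := x) (ρ.fuel x) [] b hrun
    rw [if_pos (by omega)]

end WithLocal

/-! ### Internalizing the base of a join: `M^{K ⊕ G}` as a machine with oracle `G` -/

/-- The local rule of the join `K ⊕ ·` with query bound `q`: queries longer than `q |z|` and the
empty query are answered `0`, queries `0c` by `[c ∈ K]`, queries `1c` are forwarded as `c`.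
[cite: FortnowRogers1999JCSS, proof of Thm. 4.2 (p. 7, the join H ⊕ G)] -/
def joinRule (K : Language Bool) (q : Polynomial ℕ) : LocalRule where
  loc z s := if q.eval z.length < s.length then some (encodeBool false) else
    match s with
    | [] => some (encodeBool false)
    | false :: c => some (encodeBool (K.boolIndicator c))
    | true :: _ => none
  fwd _ s := s.tail
  fuel z := q.eval z.length

/-- **The simulated oracle of the join rule is the truncated join.**
[cite: FortnowRogers1999JCSS, proof of Thm. 4.2 (p. 7, the join H ⊕ G)] -/
theorem sim_joinRule (K G : Language Bool) (q : Polynomial ℕ) (z : List Bool) :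
    (joinRule K q).sim (Oracle.ofLanguage (truncLang G (q.eval z.length))) z =
      Oracle.ofLanguage (truncLang (oracleJoin K G) (q.eval z.length)) := by
  funext s
  simp only [LocalRule.sim, joinRule, Oracle.ofLanguage_apply]
  by_cases hlen : q.eval z.length < s.length
  · rw [if_pos hlen]
    have hns : s ∉ truncLang (oracleJoin K G) (q.eval z.length) := fun hs => absurd hs.2 (not_le.2 hlen)
    simp only
    rw [(Set.notMem_iff_boolIndicator _ _).1 hns]
  · rw [if_neg hlen]
    push Not at hlen
    rcases s with _ | ⟨b, c⟩
    · have hns : ([] : List Bool) ∉ truncLang (oracleJoin K G) (q.eval z.length) := fun hs =>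
        nil_not_mem_oracleJoin hs.1
      simp only
      rw [(Set.notMem_iff_boolIndicator _ _).1 hns]
    · have key : ∀ b' : Bool, (b' :: c ∈ truncLang (oracleJoin K G) (q.eval z.length) ↔ b' :: c ∈ oracleJoin K G) :=
        fun b' => ⟨fun h' => h'.1, fun h' => ⟨h', by simpa using hlen⟩⟩
      cases b
      · simp only
        congr 1
        refine boolIndicator_eq_of_iff ((key false).trans ?_).symm
        exact false_cons_mem_oracleJoin
      · simp only [List.tail_cons]
        congr 1
        refine boolIndicator_eq_of_iff (Iff.trans ?_ ((key true).trans true_cons_mem_oracleJoin).symm)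
        constructor
        · exact fun hc => hc.1
        · intro hc
          refine ⟨hc, ?_⟩
          have : (true :: c).length ≤ q.eval z.length := hlen
          simp only [List.length_cons] at this
          omega

/-- **`baseLang` of the internalized machine relative to `G` is `baseLang` of `M` relative to
`K ⊕ G`** (the acceptance predicate of the `BPP^A` description `(M, q, ·)` of
`OracleSeparationBQPPH.lean`). [cite: FortnowRogers1999JCSS, proof of Thm. 4.2 (p. 7, the join H ⊕ G)] -/
theorem baseLang_withLocalRule_joinRule (K G : Language Bool) (M : OracleAlg Bool) (q : Polynomial ℕ) :
    baseLang (withLocalRule M (joinRule K q)) q G = baseLang M q (oracleJoin K G) := by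
  ext z
  change (withLocalRule M (joinRule K q)).run _ _ z = some true ↔ M.run _ _ z = some true
  have h := run_withLocalRule (ρ := joinRule K q) (M := M)
    (O' := Oracle.ofLanguage (truncLang G (q.eval z.length))) (x := z) (k := q.eval z.length) le_rfl
  rw [h, sim_joinRule]
  exact Iff.rfl

/-! ### Forcing a `BPP`-failure on the Forrelation promise by a finite condition -/

/-- **The failure predicate**: at level `n`, relative to `K ⊕ G`, Raz–Tal's Forrelation test `Q₁` on
the window of `G` is on one side of the promise while the acceptance probability of the
`BPP`-description `(M, q, p)` at `1ⁿ` is not. [cite: RazTalJACM2022, App. A] -/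
def PromiseLiftFailsAt (K : Language Bool) (M : OracleAlg Bool) (q p : Polynomial ℕ) (n : ℕ) (G : Language Bool) : Prop :=
  (2 / 3 ≤ q1Accept n (rtWindow G n) ∧
    uniformProb (p.eval n) {r | boolPair (List.replicate n true) r ∈ baseLang M q (oracleJoin K G)} < 2 / 3) ∨
  (q1Accept n (rtWindow G n) ≤ 1 / 3 ∧
    1 / 3 < uniformProb (p.eval n) {r | boolPair (List.replicate n true) r ∈ baseLang M q (oracleJoin K G)})

/-- **Density of the failure requirement** (the finite-extension step). For every base `K` and
description `(M, q, p)` there is a threshold `n₀` such that for every level `n ≥ n₀` and every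
condition `τ` all of whose strings are shorter than the address length `rtLen n`, some extension of
`τ` FORCES `PromiseLiftFailsAt K M q p n`: take the defeating window of the stage lemma
(`exists_defeating_window_bpp`, run against the internalized machine `withLocalRule M (joinRule K q)`
and the background `{w | τ w = 1}`, the minimal oracle extending `τ`), patch it into level `n`, and freeze everything up to the
reach of the description. [cite: RazTalJACM2022, App. A] [cite: BernsteinVazirani1997, §8.4 Cor. 8.14] -/
theorem exists_forces_promiseLiftFailsAt (K : Language Bool) (M : OracleAlg Bool) (q p : Polynomial ℕ) :
    ∃ n₀ : ℕ, ∀ n, n₀ ≤ n → ∀ τ : CohenCondition, (∀ s ∈ τ.dom, s.length < rtLen n) →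
      ∃ σ : CohenCondition, τ ≤ σ ∧ σ.Forces (PromiseLiftFailsAt K M q p n) := by
  classical
  set M' := withLocalRule M (joinRule K q) with hM'
  obtain ⟨n₀, hst⟩ := exists_defeating_window_bpp razTal2022_claim81_holds fSS84_phWindowCircuits_holds
    (razTal2022_thm74_of_tal Tal2017_fourierL1_ac0_holds) M' q p
  refine ⟨n₀, fun n hn τ hτ => ?_⟩
  set G₀ : Language Bool := {w | τ.val w = some true} with hG₀
  obtain ⟨w, β, ht, hf⟩ := hst n hn G₀
  set G₁ := patchLevel G₀ n w with hG₁
  set R := max (rtLen n) (PHDescr.reach ⟨[p], M', q⟩ n) with hR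
  set σ := CohenCondition.restrict G₁ (shortStrings (R + 1)) with hσ
  -- `G₁` extends `τ` (patching touches only strings of length `rtLen n`)
  have hG₁τ : τ.ExtendedBy G₁ := by
    intro s b hs
    have hsdom : s ∈ τ.dom := by
      change τ.val s ≠ none; rw [hs]; exact Option.some_ne_none _
    have hs1 : s ∈ G₁ ↔ s ∈ G₀ := by
      refine mem_patchLang_of_not_mem_range _ fun pk hpk => ?_
      have h1 := hτ s hsdom
      rw [← hpk] at h1
      simp [rtAddr'] at h1
    rw [hs1]
    exact BGS.extendedBy_setOf_val_eq_true τ s b hs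
  refine ⟨σ, CohenCondition.le_restrict_of_extendedBy hG₁τ fun s hs => ?_, fun G hG => ?_⟩
  · rw [Finset.mem_coe, mem_shortStrings]
    have h1 := hτ s hs
    have h2 : rtLen n ≤ R := le_max_left _ _
    omega
  · -- every `G` extending `σ` agrees with `G₁` up to length `R`
    have hagree : ∀ s : List Bool, s.length ≤ R → (s ∈ G ↔ s ∈ G₁) := fun s hs =>
      CohenCondition.ExtendedBy.mem_iff_mem hG (CohenCondition.extendedBy_restrict G₁ _)
        (by rw [CohenCondition.dom_restrict, Finset.mem_coe, mem_shortStrings]; exact Nat.lt_succ_of_le hs)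
    have hwin : rtWindow G n = w := by
      rw [← rtWindow_patchLevel G₀ n w]
      funext i k
      exact boolIndicator_eq_of_iff (hagree _ (by rw [length_rtAddr]; exact le_max_left _ _))
    have hprob : uniformProb (p.eval n)
        {r | boolPair (List.replicate n true) r ∈ baseLang M q (oracleJoin K G)} =
        uniformProb (p.eval n) {r | boolPair (List.replicate n true) r ∈ baseLang M' q G₁} := by
      rw [← baseLang_withLocalRule_joinRule K G M q]
      have h := uniformProb_baseLang_congr M' q p (A := G) (A' := G₁) (List.replicate n true)
        (fun s hs => hagree s (by rw [List.length_replicate] at hs; exact hs.trans (le_max_right _ _)))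
      rwa [List.length_replicate] at h
    unfold PromiseLiftFailsAt
    rw [hwin, hprob]
    cases β
    · exact Or.inr (hf rfl)
    · exact Or.inl (ht rfl)

/-! ### The world `K ⊕ G` -/

/-- **The promise problem of a family relative to `A`**: yes-instances accepted with probability
`≥ 2/3`, no-instances accepted with probability `≤ 1/3` (the canonical `PromiseBQP^A` problem of a
machine). [cite: Watrous2009, §III.2] -/
def machinePromise (F : QCircuitFamily cliffordT) (A : Language Bool) : PromiseProblem :=
  ⟨{x | 2 / 3 ≤ F.acceptProbOn A x}, {x | F.acceptProbOn A x ≤ 1 / 3}⟩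

/-- The promise problem of a uniform family is in `PromiseBQP^A` (by definition). [cite: Watrous2009, §III.2] -/
theorem machinePromise_mem_PromiseBQPRel {F : QCircuitFamily cliffordT} (hU : F.IsUniform) (A : Language Bool) :
    machinePromise F A ∈ PromiseBQPRel A :=
  ⟨F, hU, fun _ hx => hx, fun _ hx => hx⟩

/-- **The generic world over an arbitrary base.** For every base oracle `K` and every countable
family `𝒮c` of sets of conditions such that `P^{K ⊕ G} = AWPP^{K ⊕ G}` for all `𝒮c`-generic `G`,
there is a Cohen generic `G` — generic for `𝒮c`, for the hierarchy family of `K`, and for the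
countably many failure requirements — such that relative to `A = K ⊕ G`: `P^A = AWPP^A` (hence
`P^A = BQP^A ⊆ BPP^A`), `PH^A` is infinite, and the promise problem of the prefixed Raz–Tal machine is
in `PromiseBQP^A` but not in `PromiseBPP'^A`. [cite: FortnowRogers1999JCSS, Cor. 3.7 and its proof] [cite: RazTalJACM2022, App. A] -/
theorem exists_generic_world_of_collapse (K : Language Bool) {𝒮c : Set (Set CohenCondition)}
    (h𝒮c : 𝒮c.Countable)
    (hcoll : ∀ G : Language Bool, IsGeneric 𝒮c G →
      PRel (Oracle.ofLanguage (oracleJoin K G)) = AWPPRel (Oracle.ofLanguage (oracleJoin K G))) :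
    ∃ G : Language Bool,
      PRel (Oracle.ofLanguage (oracleJoin K G)) = AWPPRel (Oracle.ofLanguage (oracleJoin K G)) ∧
      IsInfinitePHRel (Oracle.ofLanguage (oracleJoin K G)) ∧
      ¬ (PromiseBQPRel (oracleJoin K G) ⊆ PromiseBPP'Rel (Oracle.ofLanguage (oracleJoin K G))) := by
  classical
  -- enumeration of the `BPP`-descriptions and the thresholds of the density lemma
  obtain ⟨e, he⟩ := exists_enum_PHDescr countable_polyTimeOracleAlg_holds
  choose thr hthr using fun D : PHDescr => exists_forces_promiseLiftFailsAt K D.M D.q (D.bounds.headD 0)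
  -- the requirements and their density
  set Rq : ℕ → Language Bool → Prop := fun i G =>
    ∃ n, thr (e i) ≤ n ∧ PromiseLiftFailsAt K (e i).M (e i).q ((e i).bounds.headD 0) n G with hRqdef
  have hdense : ∀ i, CohenCondition.IsDense {σ : CohenCondition | σ.Forces (Rq i)} := by
    intro i
    rw [CohenCondition.isDense_iff]
    intro τ
    obtain ⟨L, hL⟩ := BGS.exists_length_le_of_mem_dom τ
    set n := max (thr (e i)) (L + 1) with hn
    obtain ⟨σ, hτσ, hσ⟩ := hthr (e i) n (le_max_left _ _) τ fun s hs => by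
      have h1 := hL s hs
      have h2 : L + 1 ≤ n := le_max_right _ _
      have h3 := le_rtLen n
      omega
    exact ⟨σ, fun G hG => ⟨n, le_max_left _ _, hσ G hG⟩, hτσ⟩
  -- one generic for the collapse family and the hierarchy family of `K` and for all the requirements
  obtain ⟨𝒮, h𝒮, hPH⟩ := isInfinitePHRel_join_generic_holds K
  obtain ⟨G, hG⟩ := exists_isGeneric ((h𝒮c.union h𝒮).union
    (Set.countable_range fun i => {σ : CohenCondition | σ.Forces (Rq i)}))
  have hG₁ := (isGeneric_union.1 (isGeneric_union.1 hG).1).1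
  have hG₂ := (isGeneric_union.1 (isGeneric_union.1 hG).1).2
  have hG₃ := (isGeneric_union.1 hG).2
  have hRq : ∀ i, Rq i G := fun i => hG₃.of_forces (Set.mem_range_self i) (hdense i)
  refine ⟨G, hcoll G hG₁, hPH G hG₂, ?_⟩
  -- the promise problem of the prefixed Forrelation machine
  intro hsub
  obtain ⟨F, hFu, hF⟩ := razTalPrefixed_bqpMachine 0 fun _ => false
  have hacc : ∀ x, F.acceptProbOn (oracleJoin K G) x = q1Accept x.length (rtWindow G x.length) := by
    intro x
    rw [(hF (oracleJoin K G) x).2 (Nat.zero_le _), ← rtWindow_preLang]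
    have hG' : preLang (oracleJoin K G) = G := by
      ext t; exact true_cons_mem_oracleJoin
    rw [hG']
  obtain ⟨L', hL'P, p, hyes, hno⟩ := hsub (machinePromise_mem_PromiseBQPRel hFu (oracleJoin K G))
  obtain ⟨M, hM, q, hq⟩ := hL'P
  have hbase : baseLang M q (oracleJoin K G) = L' := baseLang_eq_of_PRel hq
  obtain ⟨i, hi⟩ := he (show (⟨[p], M, q⟩ : PHDescr) ∈
    {D : PHDescr | D.M.IsPolyTime encodingBoolBool} from hM)
  obtain ⟨n, -, hbad⟩ := hRq i
  rw [hi] at hbad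
  change PromiseLiftFailsAt K M q p n G at hbad
  rcases hbad with ⟨hq1, hpr⟩ | ⟨hq1, hpr⟩
  · have hmem : List.replicate n true ∈ (machinePromise F (oracleJoin K G)).yes := by
      show 2 / 3 ≤ F.acceptProbOn (oracleJoin K G) (List.replicate n true)
      rw [hacc, List.length_replicate]; exact hq1
    have h := hyes _ hmem
    rw [List.length_replicate, ← hbase] at h
    linarith
  · have hmem : List.replicate n true ∈ (machinePromise F (oracleJoin K G)).no := by
      show F.acceptProbOn (oracleJoin K G) (List.replicate n true) ≤ 1 / 3
      rw [hacc, List.length_replicate]; exact hq1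
    have h := hno _ hmem
    rw [List.length_replicate, ← hbase] at h
    have hc : {y : List Bool | boolPair (List.replicate n true) y ∉ baseLang M q (oracleJoin K G)} =
        {y : List Bool | boolPair (List.replicate n true) y ∈ baseLang M q (oracleJoin K G)}ᶜ := rfl
    rw [hc, Literature.Computability.Complexity.uniformProb_compl] at h
    linarith

/-- **The world** (unconditional): for the brain oracle `K` of the tree's Fortnow–Rogers world
(`Cor37Brain.oracleK`, whose Standard-Algorithm collapse `Cor37Brain.stdAlg_oracleK` feeds
`FFKL.PRel_eq_AWPPRel_of_isGeneric_of_stdAlg`) there is a Cohen generic `G` with, relative to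
`A = K ⊕ G`: `P^A = AWPP^A`, `PH^A` infinite, and `PromiseBQP^A ⊄ PromiseBPP'^A`.
[cite: FortnowRogers1999JCSS, Cor. 3.7 and its proof] [cite: FennerFortnowKurtzLi2003IC, Thm. 6.18 (2)] -/
theorem exists_generic_world :
    ∃ G : Language Bool,
      PRel (Oracle.ofLanguage (oracleJoin Cor37Brain.oracleK G)) =
          AWPPRel (Oracle.ofLanguage (oracleJoin Cor37Brain.oracleK G)) ∧
      IsInfinitePHRel (Oracle.ofLanguage (oracleJoin Cor37Brain.oracleK G)) ∧
      ¬ (PromiseBQPRel (oracleJoin Cor37Brain.oracleK G) ⊆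
          PromiseBPP'Rel (Oracle.ofLanguage (oracleJoin Cor37Brain.oracleK G))) :=
  exists_generic_world_of_collapse Cor37Brain.oracleK (FFKL.family_countable Cor37Brain.oracleK)
    fun _ hG => FFKL.PRel_eq_AWPPRel_of_isGeneric_of_stdAlg Cor37Brain.stdAlg_oracleK hG

/-- **The printed Fortnow–Rogers world `H ⊕ G` does not extend either** (conditional on the named
fact `fennerFortnowKurtzLi2003_thm618_awpp`, Fenner–Fortnow–Kurtz–Li Thm. 6.18 (2) rerelativized to
a `PSPACE`-complete `H`): for every Karp-`PSPACE`-complete `H` some generic `G` for the collapse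
family of the fact, the hierarchy family and the failure requirements gives `P^{H ⊕ G} = AWPP^{H ⊕ G}`,
`PH^{H ⊕ G}` infinite and `PromiseBQP^{H ⊕ G} ⊄ PromiseBPP'^{H ⊕ G}`.
[cite: FortnowRogers1999JCSS, Thm. 3.6, Cor. 3.7 and proof of Thm. 4.2] [cite: FennerFortnowKurtzLi2003IC, Thm. 6.18 (2) and pp. 33–34] -/
theorem exists_generic_world_of_thm618 (h618 : fennerFortnowKurtzLi2003_thm618_awpp)
    {H : Language Bool} (hH : IsComplete PSPACE H) :
    ∃ G : Language Bool,
      PRel (Oracle.ofLanguage (oracleJoin H G)) = AWPPRel (Oracle.ofLanguage (oracleJoin H G)) ∧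
      IsInfinitePHRel (Oracle.ofLanguage (oracleJoin H G)) ∧
      ¬ (PromiseBQPRel (oracleJoin H G) ⊆ PromiseBPP'Rel (Oracle.ofLanguage (oracleJoin H G))) := by
  obtain ⟨𝒮c, h𝒮c, hcoll⟩ := h618 H hH
  exact exists_generic_world_of_collapse H h𝒮c hcoll

/-- **The world, in the form needed by the barrier**: `BQP^{K ⊕ G} ⊆ BPP^{K ⊕ G}` (through
`BQP ⊆ AWPP = P ⊆ BPP`, tree theorems `BQPRel_subset_AWPPRel_holds`, `PRel_subset_BPPRel_holds`) and
`PromiseBQP^{K ⊕ G} ⊄ PromiseBPP'^{K ⊕ G}`. [cite: FortnowRogers1999JCSS, Cor. 3.7 and Thm. 3.1] -/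
theorem exists_generic_promiseLift_fails :
    ∃ G : Language Bool,
      BQPRel (oracleJoin Cor37Brain.oracleK G) ⊆ BPPRel (Oracle.ofLanguage (oracleJoin Cor37Brain.oracleK G)) ∧
      ¬ (PromiseBQPRel (oracleJoin Cor37Brain.oracleK G) ⊆
          PromiseBPP'Rel (Oracle.ofLanguage (oracleJoin Cor37Brain.oracleK G))) := by
  obtain ⟨G, hPA, -, hsep⟩ := exists_generic_world
  refine ⟨G, fun L hL => ?_, hsep⟩
  have h1 := BQPRel_subset_AWPPRel_holds (oracleJoin Cor37Brain.oracleK G) hL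
  rw [← hPA] at h1
  exact PRel_subset_BPPRel_holds _ h1

/-- **Aaronson–Arkhipov's table row, decided for this world**: an oracle relative to which
`P = BQP` and `PH` is infinite (as in Fortnow–Rogers' Cor. 3.7) but `PromiseBQP ⊄ PromiseBPP'`, so in
particular `PromiseP ≠ PromiseBQP` there — the Fortnow–Rogers construction (with the brain base and
a generic meeting the failure requirements) does NOT extend to `PromiseP = PromiseBQP` ("it is not
even known how to extend the Fortnow–Rogers construction to get an oracle `A` relative to which
`PromiseP = PromiseBQP` but `PH` is infinite"). `P^A ⊆ BQP^A` is the tree's `P ⊆ BPP ⊆ BQP`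
relativized (`uniformOracleCoinSimulation_holds`).
[cite: AaronsonArkhipov2013, §10, open problem (10) (p. 236)] [cite: FortnowRogers1999JCSS, Cor. 3.7] -/
theorem exists_oracle_P_eq_BQP_infinitePH_promiseBQP_not_subset :
    ∃ A : Language Bool, PRel (Oracle.ofLanguage A) = BQPRel A ∧ IsInfinitePHRel (Oracle.ofLanguage A) ∧
      ¬ (PromiseBQPRel A ⊆ PromiseBPP'Rel (Oracle.ofLanguage A)) := by
  obtain ⟨G, hPA, hPH, hsep⟩ := exists_generic_world
  refine ⟨oracleJoin Cor37Brain.oracleK G, Set.Subset.antisymm ?_ ?_, hPH, hsep⟩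
  · exact PRel_ofLanguage_subset_BQPRel_of_BPPRel
      (BPPRel_ofLanguage_subset_BQPRel_of_sim uniformOracleCoinSimulation_holds) PRel_subset_BPPRel_holds _
  · rw [hPA]
    exact BQPRel_subset_AWPPRel_holds _

/-! ### The barrier fact -/

/-- **The promise lift does not relativize** (new; this file): there is an oracle language `A` with
`BQP^A ⊆ BPP^A` and `PromiseBQP^A ⊄ PromiseBPP'^A` — a world with NO quantum advantage for
LANGUAGES (bounded-error) but WITH quantum advantage for PROMISE PROBLEMS. PROVED below
(`PromiseLiftRelativization.holds`: `A = K ⊕ G`, the brain oracle of the Fortnow–Rogers world joined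
with a suitable Cohen generic).

BARRIER
technique_class: relativizing, oracle-independent, promise-lift, promise-completeness, structural, black-box
blocks: every relativizing proof of the route item `PlLift : BQP ⊆ BPP → PromiseBQP ⊆ PromiseBPP'` (stmt-QuantumAdvantage-0250; the `O = ∅` instance of `O ↦ (BQP^O ⊆ BPP^O → PromiseBQP^O ⊆ PromiseBPP'^O)`, see `promiseLift_shape_empty_iff`), of the promise collapse `PromiseBQP ⊆ PromiseBPP'` (negation of route PromiseLift's thesis `PlThesis`), and of every RELATIVIZING SUFFICIENT CONDITION for `PlLift` — in particular `PlPromiseIsLift : PromiseBQP ⊆ promiseLift BQP` and its Jones/Forrelation faces (route PromiseLift #3/#4), whose glue to `PlLift` relativizes (`not_PromiseBQPRel_subset_promiseLift`); proved instances: `not_relativizes_promiseLift`, `not_relativizes_promiseCollapse`, `not_PromiseBQPRel_subset_promiseLift`.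
because: relative to `A = K ⊕ G` — `K` the brain oracle of the tree's Fortnow–Rogers world, `G` Cohen generic — the collapse `BQP^A ⊆ AWPP^A = P^A ⊆ BPP^A` holds (Fortnow–Rogers' relativizing `BQP ⊆ AWPP` and the Fenner–Fortnow–Kurtz–Li generic collapse of `AWPP` to `P`, both proved in the tree) [cite: FortnowRogers1999JCSS, Thm. 3.1, Thm. 3.6, Cor. 3.7] [cite: FennerFortnowKurtzLi2003IC, Thm. 6.18 (2)], while the promise problem of Raz–Tal's amplified Forrelation machine reading the window of `G` (prefixed queries `1 · rtAddr`) is in `PromiseBQP^A` by definition and outside `PromiseBPP'^A`: each `BPP^A` description is defeated at some level by the stage lemma of the oracle separation `BQP^O ⊄ BPP^O` [cite: RazTalJACM2022, App. A, Claims 8.1–8.2] [cite: BernsteinVazirani1997, §8.4 Cor. 8.14], and the defeat is FORCED by a finite Cohen condition (finite extension with the base `K` internalized into the classical machine), hence met by the generic; the language `{1ⁿ : acc ≥ 2/3}` of the same machine is garbage at most levels of a generic, which is why the language separation dies in this world while the promise separation survives — Goldreich's obstruction "no gap off the promise" [cite: Goldreich2006, §1.2] realised relative to an oracle; contrary oracles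 (`A` here; the empty-promise direction holds everywhere, `relativizes_promiseLift_converse`) make the lift non-relativizing [cite: AroraBarakCC2009, §3.4 and Thm. 3.7, p. 74].
evasions_known: none in print for the lift itself — Aaronson–Arkhipov list the extension of the Fortnow–Rogers world to `PromiseP = PromiseBQP` as open [cite: AaronsonArkhipov2013, §10, open problems (9)–(10)] and the classical analogue `BPP = P ⟹ prBPP = prP` is open [cite: Goldreich2011, §6]; a proof of the lift must use non-relativizing (white-box) structure of a specific `PromiseBQP`-complete promise problem, e.g. a `BQP` LANGUAGE separating the Aharonov–Jones–Landau problem built from the `ℤ[ζ₅]`-arithmetic of the path-model representation (route PromiseLift #4), for which no relativized obstruction beyond this one is claimed.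
scope_caveats: (a) the formal content is `∃ A, BQPRel A ⊆ BPPRel (ofLanguage A) ∧ ¬ (PromiseBQPRel A ⊆ PromiseBPP'Rel (ofLanguage A))` in the tree's models — `BQPRel`/`PromiseBQPRel`: poly-time uniform Clifford+T families with XOR-query gates; `BPPRel`/`PromiseBPP'Rel`: `bp`/promise-`bp` of the transcript-model `P^O`; only language oracles are quantified; (b) the same world has `P^A = BQP^A` and `PH^A` infinite (`exists_oracle_P_eq_BQP_infinitePH_promiseBQP_not_subset`), deciding Aaronson–Arkhipov's question (10) negatively for the Fortnow–Rogers-type world with the brain base; whether SOME oracle has `PromiseP = PromiseBQP` with `PH` infinite stays open; (c) nothing is said about the unrelativized lift, which stays open — by `not_plLift`-type bookkeeping an outright refutation of `PlLift` would refute the summit (it needs `BQP ⊆ BPP`); (d) algebrization (Aaronson–Wigderson) of the lift is not treated.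
status: established (theorem; proved in this file, axioms `propext`, `Classical.choice`, `Quot.sound`) [cite: FortnowRogers1999JCSS, Cor. 3.7] [cite: RazTalJACM2022, Cor. 1.5 (App. A)] -/
def PromiseLiftRelativization : Prop :=
  ∃ A : Language Bool, BQPRel A ⊆ BPPRel (Oracle.ofLanguage A) ∧
    ¬ (PromiseBQPRel A ⊆ PromiseBPP'Rel (Oracle.ofLanguage A))

/-- **`PromiseLiftRelativization` holds** (the world `K ⊕ G` of `exists_generic_promiseLift_fails`).
[cite: FortnowRogers1999JCSS, Cor. 3.7] [cite: RazTalJACM2022, App. A] -/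
theorem PromiseLiftRelativization.holds : PromiseLiftRelativization := by
  obtain ⟨G, h1, h2⟩ := exists_generic_promiseLift_fails
  exact ⟨_, h1, h2⟩

/-! ### The no-go theorems -/

/-- `PresentsPromiseBQPRel PC`: the oracle-indexed promise class `PC` agrees with `PromiseBQPRel` on
language oracles (the promise analogue of `PresentsBQPRel`). [folklore] -/
def PresentsPromiseBQPRel (PC : Oracle → Set PromiseProblem) : Prop :=
  ∀ A : Language Bool, PC (Oracle.ofLanguage A) = PromiseBQPRel A

/-- The canonical presentation `O ↦ PromiseBQP^{oracleLanguage O}`. [folklore] -/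
def promiseBQPRelOf (O : Oracle) : Set PromiseProblem :=
  PromiseBQPRel (oracleLanguage O)

/-- The canonical presentation agrees with `PromiseBQPRel` on language oracles. [folklore] -/
theorem presentsPromiseBQPRel_promiseBQPRelOf : PresentsPromiseBQPRel promiseBQPRelOf :=
  fun A => by simp [promiseBQPRelOf]

/-- **The promise lift `O ↦ (BQP^O ⊆ BPP^O → PromiseBQP^O ⊆ PromiseBPP'^O)` does not relativize**
(it fails at the oracle of `PromiseLiftRelativization`), for every presentation of the quantum
classes. [cite: AroraBarakCC2009, Thm. 3.7 and p. 74] [cite: AaronsonArkhipov2013, §10 (10)] -/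
theorem not_relativizes_promiseLift (h : PromiseLiftRelativization)
    {C : Oracle → Set (Language Bool)} (hC : PresentsBQPRel C)
    {PC : Oracle → Set PromiseProblem} (hPC : PresentsPromiseBQPRel PC) :
    ¬ Relativizes fun O => (C O ⊆ BPPRel O → PC O ⊆ PromiseBPP'Rel O) := by
  obtain ⟨A, hA, hnA⟩ := h
  intro hrel
  have h1 : C (Oracle.ofLanguage A) ⊆ BPPRel (Oracle.ofLanguage A) →
      PC (Oracle.ofLanguage A) ⊆ PromiseBPP'Rel (Oracle.ofLanguage A) := hrel A
  rw [hC A, hPC A] at h1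
  exact hnA (h1 hA)

/-- **The promise collapse `O ↦ PromiseBQP^O ⊆ PromiseBPP'^O` does not relativize** (same oracle; it
also fails at every oracle separating the languages, e.g. Raz–Tal's).
[cite: AroraBarakCC2009, Thm. 3.7 and p. 74] -/
theorem not_relativizes_promiseCollapse (h : PromiseLiftRelativization)
    {PC : Oracle → Set PromiseProblem} (hPC : PresentsPromiseBQPRel PC) :
    ¬ Relativizes fun O => PC O ⊆ PromiseBPP'Rel O := by
  obtain ⟨A, -, hnA⟩ := h
  intro hrel
  have h1 : PC (Oracle.ofLanguage A) ⊆ PromiseBPP'Rel (Oracle.ofLanguage A) := hrel A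
  rw [hPC A] at h1
  exact hnA h1

/-- **The converse lift relativizes**: at every language oracle a promise collapse gives the
language collapse (trivial promises, `BQPRel_subset_BPPRel_of_promise`).
[cite: Goldreich2006, §1.2] -/
theorem relativizes_promiseLift_converse
    {C : Oracle → Set (Language Bool)} (hC : PresentsBQPRel C)
    {PC : Oracle → Set PromiseProblem} (hPC : PresentsPromiseBQPRel PC) :
    Relativizes fun O => (PC O ⊆ PromiseBPP'Rel O → C O ⊆ BPPRel O) := by
  intro A
  show PC (Oracle.ofLanguage A) ⊆ PromiseBPP'Rel (Oracle.ofLanguage A) → C (Oracle.ofLanguage A) ⊆ BPPRel (Oracle.ofLanguage A)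
  rw [hC A, hPC A]
  exact BQPRel_subset_BPPRel_of_promise

/-- The strong relativized promise-`BPP` is contained in the textbook one: a `BPP^O` language
separating `Q` has a `2/3`-correct witness on every input (relativized `PromiseBPP_subset_PromiseBPP'`).
[cite: Goldreich2006, §1.2 (Def. 2)] -/
theorem promiseLift_BPPRel_subset_PromiseBPP'Rel (O : Oracle) : promiseLift (BPPRel O) ⊆ PromiseBPP'Rel O := by
  rintro Q ⟨L, ⟨L', hL', p, h⟩, hyes, hno⟩
  refine ⟨L', hL', p, fun x hx => ?_, fun x hx => ?_⟩
  · have hx' : x ∈ L := hyes hx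
    rw [← setOf_boolPair_mem_iff_of_mem hx']; exact h x
  · have hx' : x ∉ L := fun h' => hno hx h'
    have hc : {y : List Bool | boolPair x y ∉ L'} = {y | boolPair x y ∈ L' ↔ x ∈ L} := by
      ext y; simp [hx']
    rw [hc]; exact h x

/-- **The separability hypothesis fails relative to the same oracle**: at the oracle `A` of
`PromiseLiftRelativization`, `PromiseBQP^A ⊄ promiseLift (BQP^A)` — no `BQP^A` LANGUAGE separates
every `PromiseBQP^A` problem (else `PromiseBQP^A ⊆ promiseLift BQP^A ⊆ promiseLift BPP^A ⊆
PromiseBPP'^A`). So route PromiseLift's `PlPromiseIsLift : PromiseBQP ⊆ promiseLift BQP` and its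
glue to `PlLift` have no relativizing proof either (cf. Fortnow–Rogers 1999, Cor. 3.11: a world where
`BQP` has no `BPP`-hard sets). [cite: FortnowRogers1999JCSS, Cor. 3.7 and Cor. 3.11] -/
theorem not_PromiseBQPRel_subset_promiseLift (h : PromiseLiftRelativization) :
    ∃ A : Language Bool, BQPRel A ⊆ BPPRel (Oracle.ofLanguage A) ∧
      ¬ (PromiseBQPRel A ⊆ promiseLift (BQPRel A)) := by
  obtain ⟨A, hA, hnA⟩ := h
  refine ⟨A, hA, fun hsep => hnA ?_⟩
  exact hsep.trans ((promiseLift_mono hA).trans (promiseLift_BPPRel_subset_PromiseBPP'Rel _))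

/-! ### Anchor: the empty-oracle instance is the route item `PlLift` -/

/-- The canonical promise presentation at the empty oracle is `PromiseBQP`
(`oracleLanguage ∅ = 0`, `PromiseBQPRel_zero`). [cite: BernsteinVazirani1997, §8.3 (oracle QTMs)] -/
theorem promiseBQPRelOf_empty : promiseBQPRelOf Oracle.empty = PromiseBQP := by
  change PromiseBQPRel (oracleLanguage (Oracle.ofLanguage 0)) = PromiseBQP
  rw [oracleLanguage_ofLanguage, PromiseBQPRel_zero]

/-- **At the empty oracle the family `O ↦ (BQP^O ⊆ BPP^O → PromiseBQP^O ⊆ PromiseBPP'^O)` (canonical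
presentations) is literally the route item `PlLift : BQP ⊆ BPP → PromiseBQP ⊆ PromiseBPP'`**
(through `BPPRel_empty`, `bqpRelOf_empty`, `promiseBQPRelOf_empty`, `PromiseBPP'Rel_empty`, all
discharged); `Relativizes.empty` specialises any relativizing statement to this instance.
[cite: AaronsonArkhipov2013, §10 (open problems (9)–(10))] -/
theorem promiseLift_shape_empty_iff :
    (bqpRelOf Oracle.empty ⊆ BPPRel Oracle.empty → promiseBQPRelOf Oracle.empty ⊆ PromiseBPP'Rel Oracle.empty) ↔
      (BQP ⊆ BPP → PromiseBQP ⊆ PromiseBPP') := by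
  rw [BPPRel_empty PRel_empty_holds, bqpRelOf_empty BQPRel_zero_holds, promiseBQPRelOf_empty, PromiseBPP'Rel_empty]

end Literature.Barriers.QuantumAdvantage

end

/-! ## `_holds` aliases (appended 2026-08-28)

The named fact(s) below are already theorems of the tree under another name; the `_holds`
alias records the discharge under the tree's naming convention (D-0026 bookkeeping: proof term =
the existing theorem, no statement or definition edited). -/

/-- `PromiseLiftRelativization` is a theorem of the tree (`Literature.Barriers.QuantumAdvantage.PromiseLiftRelativization.holds`). [cite: FortnowRogers1999JCSS, Thm. 3.1, Thm. 3.6, Cor. 3.7] [cite: FennerFortnowKurtzLi2003IC, Thm. 6.18 (2)] -/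
theorem _root_.Literature.Barriers.QuantumAdvantage.PromiseLiftRelativization_holds : _root_.Literature.Barriers.QuantumAdvantage.PromiseLiftRelativization :=
  _root_.Literature.Barriers.QuantumAdvantage.PromiseLiftRelativization.holds
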